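import Literature.NumberTheory.Automorphic.UnitaryGroupDirectSumCarriers
import HarnessLib

/-!
# Direct sums on the FIRST member of a dual pair: `U(V₁)(𝔸) × U(V₂)(𝔸) ⊂ U(V₁ ⊕ V₂)(𝔸)` against a fixed `W`,
# and the see-saw squares `(V₁ ⊕ V₂) ⊗ W = (V₁ ⊗ W) ⊕ (V₂ ⊗ W)` on `pairToSymplectic` and on adelic points

Topic `NumberTheory/Automorphic`; namespace `Literature.NumberTheory.Automorphic.UnitaryGroup`.  The mirror image of
`UnitaryGroupDirectSumCarriers` (§0, §2) and of `UnitaryGroupDirectSum` §4 (`reindex_kronecker_fromBlocks_diag`,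
`resAut_kroneckerGL_blockDiagGL`), which split the SECOND member `W = W₁ ⊕ W₂` of the dual pair `(U(V), U(W))`: here the
FIRST member is split, `V = V₁ ⊕ V₂` with `W` fixed — the see-saw `(U(V₁) × U(V₂), U(W) × U(W))` versus `(U(V₁ ⊕ V₂), U(W))`
in `Sp(Res((V₁ ⊕ V₂) ⊗ W))` [Kudla1984, §1].  This is the embedding used by [Liu2021] in the proof of Thm. 4.15 (Camb. J.
Math. 9 (2021), arXiv:2102.11518 `FJcycle.tex` l. 2193–2210): for an orthogonal decomposition `V = V⋆ ⊕ V⋆^⊥` of the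
hermitian space, the restriction of the Weil representation of `U(V)` (dual pair `(U(V), U(W_e))`, `W_e` a skew-hermitian
line) to `U(V⋆) × U(V⋆^⊥)` is the exterior tensor product of the Weil representations of the two smaller pairs, so that
theta functions restrict to (sums of products of) theta functions («We claim that the map … induced by the inclusion
`G⋆ ↪ G` sends `V(μ,e)` to `V⋆(μ,e)`», l. 2199).  The present file supplies the Sp-LEVEL square (the hypothesis `hs`/`hS` of
the abstract see-saw theorems `GelbartRogawski1991.UnitaryDualPair.thetaDistLM_mpSeesaw_tensorToSum` and
`Weil1964.AdelicMetaplecticSeesawSum`) for that V-side see-saw; nothing metaplectic is done here.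

Definitions: NONE (the index relabelling `Fin (N₁ + N₂) × Fin M ≃ (Fin N₁ × Fin M) ⊕ (Fin N₂ × Fin M)` is written out as
`(finSumFinEquiv.prodCongr (Equiv.refl (Fin M))).symm.trans (Equiv.sumProdDistrib (Fin N₁) (Fin N₂) (Fin M))`, and the
block-diagonal carrier is the existing `adelicBlockDiag F E c N₁ N₂ J₁ J₂`, read for hermitian Gram matrices `J₁, J₂` of the
two summands of `V`).  Proved lemmas only; no named facts, 0 proof holes.

* §0 (generic, any commutative rings; the three matrix/`GL` relabelling lemmas `reindex_fromBlocks_diag_kronecker`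
  (`(A₁ ⊕ A₂) ⊗ B = (A₁ ⊗ B) ⊕ (A₂ ⊗ B)` along `Equiv.sumProdDistrib`), `reindexGL_blockDiagGL_kroneckerGL`,
  `kroneckerGL_reindexGL_left` are file-private plumbing): `IsQuadraticCoordinates.resAut_blockDiagGL_kroneckerGL` (restriction of scalars: `Res(diag(g₁,g₂) ⊗ u) =
  Res(g₁ ⊗ u) ⊕ Res(g₂ ⊗ u)`), and the `Fin`-indexed forms `reindex_finSum_kronecker`,
  `IsQuadraticCoordinates.resAut_blockDiagFin_kroneckerGL`, `IsQuadraticCoordinates.pairToSymplectic_blockDiagFin_dualPair`;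
* §1 (number fields): `adelicPairToSymplectic_adelicBlockDiag_dualPair` — for `g_j ∈ U(J_j)(𝔸_F)`, `u ∈ U(J_W)(𝔸_F)`,
  `spReindex e (toSp[V₁ ⊕ V₂, W] ((g₁ ⊕ᶠ g₂) ⊗ u)) = spSum (toSp[V₁, W] (g₁ ⊗ u), toSp[V₂, W] (g₂ ⊗ u))` as automorphisms of
  the common adelic symplectic space.
[folklore] throughout; see-saw context [Kudla1984, §1], [Liu2021, proof of Thm. 4.15].

References:
* [Kudla1984] S. Kudla, *Seesaw dual reductive pairs*, Progr. Math. 46 (1984) 244–268, §1.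
* [Liu2021] Y. Liu, *Fourier–Jacobi cycles and arithmetic relative trace formula*, Camb. J. Math. 9 (2021), proof of
  Thm. 4.15 (arXiv `FJcycle.tex` l. 2193–2210).
-/

set_option autoImplicit false

noncomputable section

open Matrix NumberField IsDedekindDomain
open scoped Kronecker
open Literature.RepresentationTheory.HeisenbergGroup

namespace Literature.NumberTheory.Automorphic

namespace UnitaryGroup

/-! ## 0. Generic: block-diagonal on the LEFT factor of a Kronecker product -/

section Generic

variable {R S : Type*} [CommRing R] [CommRing S]
variable {n₁ n₂ m n n' : Type*} [Fintype n₁] [Fintype n₂] [Fintype m] [Fintype n] [Fintype n']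
  [DecidableEq n₁] [DecidableEq n₂] [DecidableEq m] [DecidableEq n] [DecidableEq n']

omit [Fintype n₁] [Fintype n₂] [Fintype m] [DecidableEq n₁] [DecidableEq n₂] [DecidableEq m] in
/-- **`(A₁ ⊕ A₂) ⊗ B = (A₁ ⊗ B) ⊕ (A₂ ⊗ B)`** after the relabelling
`(n₁ ⊕ n₂) × m ≃ (n₁ × m) ⊕ (n₂ × m)` (`Equiv.sumProdDistrib`).  File-private matrix plumbing. [folklore] -/
private theorem reindex_fromBlocks_diag_kronecker (A₁ : Matrix n₁ n₁ S) (A₂ : Matrix n₂ n₂ S) (B : Matrix m m S) :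
    Matrix.reindex (Equiv.sumProdDistrib n₁ n₂ m) (Equiv.sumProdDistrib n₁ n₂ m) (Matrix.fromBlocks A₁ 0 0 A₂ ⊗ₖ B) =
      Matrix.fromBlocks (A₁ ⊗ₖ B) 0 0 (A₂ ⊗ₖ B) := by
  ext i j
  rcases i with ⟨a, b⟩ | ⟨a, b⟩ <;> rcases j with ⟨a', b'⟩ | ⟨a', b'⟩ <;>
    simp [Matrix.kroneckerMap_apply]

/-- **`diag(g₁, g₂) ⊗ u = diag(g₁ ⊗ u, g₂ ⊗ u)`** in `GL` after the relabelling `Equiv.sumProdDistrib`.  File-private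
plumbing. [folklore] -/
private theorem reindexGL_blockDiagGL_kroneckerGL (g : GL n₁ S × GL n₂ S) (u : GL m S) :
    reindexGL (Equiv.sumProdDistrib n₁ n₂ m) (kroneckerGL (blockDiagGL g, u)) =
      blockDiagGL (kroneckerGL (g.1, u), kroneckerGL (g.2, u)) :=
  Units.ext (by
    rw [coe_reindexGL, coe_kroneckerGL, coe_blockDiagGL, coe_blockDiagGL, coe_kroneckerGL, coe_kroneckerGL]
    exact reindex_fromBlocks_diag_kronecker _ _ _)

/-- **`reindex e g ⊗ w = reindex (e × 1) (g ⊗ w)`** in `GL`.  File-private plumbing. [folklore] -/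
private theorem kroneckerGL_reindexGL_left (e : n ≃ n') (g : GL n S) (w : GL m S) :
    kroneckerGL (reindexGL e g, w) = reindexGL (e.prodCongr (Equiv.refl m)) (kroneckerGL (g, w)) :=
  Units.ext (by
    rw [coe_kroneckerGL, coe_reindexGL, coe_reindexGL, coe_kroneckerGL]
    exact Matrix.kroneckerMap_reindex_left _ e e _ _)

variable {φ : R →+* S} {Ψ : (R × R) ≃+ S} {δ : S} {d : R}

/-- **The see-saw identity for restriction of scalars, first member split**: for `g_j ∈ GL(V_j)`, `u ∈ GL(W)`,
`e ∘ Res(diag(g₁, g₂) ⊗ u) ∘ e⁻¹ = Res(g₁ ⊗ u) ⊕ Res(g₂ ⊗ u)` with `e = Equiv.sumProdDistrib`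
(as automorphisms of `R^{(n₁ × m) ⊕ (n₂ × m)} × R^{(n₁ × m) ⊕ (n₂ × m)}`). [cite: Kudla1984, §1] -/
theorem IsQuadraticCoordinates.resAut_blockDiagGL_kroneckerGL (h : IsQuadraticCoordinates φ Ψ δ d)
    (g : GL n₁ S × GL n₂ S) (u : GL m S) :
    ((reindexW R (Equiv.sumProdDistrib n₁ n₂ m)).symm.trans
          (h.resAut ((n₁ ⊕ n₂) × m) (kroneckerGL (blockDiagGL g, u)))).trans
        (reindexW R (Equiv.sumProdDistrib n₁ n₂ m)) =
      spSumEquiv (h.resAut (n₁ × m) (kroneckerGL (g.1, u))) (h.resAut (n₂ × m) (kroneckerGL (g.2, u))) := by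
  rw [← h.resAut_reindexGL, reindexGL_blockDiagGL_kroneckerGL, h.resAut_blockDiagGL]

end Generic

/-! ## 0′. The `Fin`-indexed forms (`V = V₁ ⊕ V₂` carried by `Fin (N₁ + N₂)` with Gram matrix `T₁ ⊕ᶠ T₂`) -/

section GenericFin

variable {R S : Type*} [CommRing R] [CommRing S] {N₁ N₂ M : ℕ}

/-- Gram matrices: **`reindex ((T₁ ⊕ᶠ T₂) ⊗ T_W) = (T₁ ⊗ T_W) ⊕ (T₂ ⊗ T_W)`** along
`(finSumFinEquiv × 1)⁻¹ ≫ Equiv.sumProdDistrib` (the form on `(V₁ ⊕ V₂) ⊗ W` is the orthogonal sum of the forms on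
`V_j ⊗ W`; so the two sides of the see-saw identity below live in the SAME symplectic group) — the orthogonal decomposition
`(V₁ ⊕ V₂) ⊗ W = (V₁ ⊗ W) ⊕ (V₂ ⊗ W)` of the symplectic space of the see-saw. [cite: Kudla1984, §1] -/
theorem reindex_finSum_kronecker (A₁ : Matrix (Fin N₁) (Fin N₁) S) (A₂ : Matrix (Fin N₂) (Fin N₂) S)
    (B : Matrix (Fin M) (Fin M) S) :
    Matrix.reindex
        ((finSumFinEquiv.prodCongr (Equiv.refl (Fin M))).symm.trans (Equiv.sumProdDistrib (Fin N₁) (Fin N₂) (Fin M)))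
        ((finSumFinEquiv.prodCongr (Equiv.refl (Fin M))).symm.trans (Equiv.sumProdDistrib (Fin N₁) (Fin N₂) (Fin M)))
        (finSum N₁ N₂ A₁ A₂ ⊗ₖ B) =
      Matrix.fromBlocks (A₁ ⊗ₖ B) 0 0 (A₂ ⊗ₖ B) := by
  rw [← reindex_fromBlocks_diag_kronecker, finSum, Matrix.kroneckerMap_reindex_left]
  ext i j
  simp only [Matrix.reindex_apply, Matrix.submatrix_apply, Equiv.symm_trans_apply, Equiv.symm_symm,
    Equiv.symm_apply_apply]

variable {φ : R →+* S} {Ψ : (R × R) ≃+ S} {δ : S} {d : R}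

/-- **The see-saw identity for restriction of scalars, first member split, `Fin`-indexed blocks**: for
`g_j ∈ GL_{N_j}`, `u ∈ GL_M`, `e ∘ Res((g₁ ⊕ᶠ g₂) ⊗ u) ∘ e⁻¹ = Res(g₁ ⊗ u) ⊕ Res(g₂ ⊗ u)` with
`e = (finSumFinEquiv × 1)⁻¹ ≫ Equiv.sumProdDistrib`. [cite: Kudla1984, §1] -/
theorem IsQuadraticCoordinates.resAut_blockDiagFin_kroneckerGL (h : IsQuadraticCoordinates φ Ψ δ d)
    (g : GL (Fin N₁) S × GL (Fin N₂) S) (u : GL (Fin M) S) :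
    ((reindexW R ((finSumFinEquiv.prodCongr (Equiv.refl (Fin M))).symm.trans
            (Equiv.sumProdDistrib (Fin N₁) (Fin N₂) (Fin M)))).symm.trans
          (h.resAut (Fin (N₁ + N₂) × Fin M) (kroneckerGL (reindexGL finSumFinEquiv (blockDiagGL g), u)))).trans
        (reindexW R ((finSumFinEquiv.prodCongr (Equiv.refl (Fin M))).symm.trans
          (Equiv.sumProdDistrib (Fin N₁) (Fin N₂) (Fin M)))) =
      spSumEquiv (h.resAut (Fin N₁ × Fin M) (kroneckerGL (g.1, u))) (h.resAut (Fin N₂ × Fin M) (kroneckerGL (g.2, u))) := by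
  rw [← h.resAut_blockDiagGL_kroneckerGL, kroneckerGL_reindexGL_left, h.resAut_reindexGL, reindexW_trans,
    reindexW_symm]
  refine LinearEquiv.ext fun v => ?_
  simp only [LinearEquiv.trans_apply, LinearEquiv.symm_trans_apply, LinearEquiv.symm_symm, LinearEquiv.symm_apply_apply]

/-- **The see-saw squares on `pairToSymplectic`, first member split, `Fin`-indexed** (`H_• = T_• ⊗ 1`,
`V = V₁ ⊕ V₂` carried by `Fin (N₁ + N₂)` with Gram matrix `T₁ ⊕ᶠ T₂`, `W` fixed with Gram `T_W`): for
`G = (g₁ ⊕ᶠ g₂) ⊗ u`,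
`spReindex e (pairToSymplectic[V₁ ⊕ V₂, W] G) = spSum (pairToSymplectic[V₁, W] (g₁ ⊗ u), pairToSymplectic[V₂, W] (g₂ ⊗ u))`
as automorphisms of the common symplectic space. [cite: Kudla1984, §1] -/
theorem IsQuadraticCoordinates.pairToSymplectic_blockDiagFin_dualPair (h : IsQuadraticCoordinates φ Ψ δ d)
    {T₁ : Matrix (Fin N₁) (Fin N₁) R} {T₂ : Matrix (Fin N₂) (Fin N₂) R} {TW : Matrix (Fin M) (Fin M) R}
    (h₁ : T₁.IsSymm) (h₂ : T₂.IsSymm) (hW : TW.IsSymm) {σ : S →+* S} (hσφ : ∀ a, σ (φ a) = φ a) (hσδ : σ δ = -δ)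
    {H₁ : Matrix (Fin N₁) (Fin N₁) S} {H₂ : Matrix (Fin N₂) (Fin N₂) S} {HW : Matrix (Fin M) (Fin M) S}
    (hH₁ : H₁ = T₁.map φ) (hH₂ : H₂ = T₂.map φ) (hHW : HW = TW.map φ)
    (g : unitaryGroupOfForm σ H₁ × unitaryGroupOfForm σ H₂) (u : unitaryGroupOfForm σ HW) :
    ((spReindex ((finSumFinEquiv.prodCongr (Equiv.refl (Fin M))).symm.trans
            (Equiv.sumProdDistrib (Fin N₁) (Fin N₂) (Fin M))) (finSum N₁ N₂ T₁ T₂ ⊗ₖ TW)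
          (h.pairToSymplectic (isSymm_finSum h₁ h₂) hW hσφ hσδ
            (show finSum N₁ N₂ H₁ H₂ = (finSum N₁ N₂ T₁ T₂).map φ by rw [hH₁, hH₂, finSum_map]) hHW
            (dualPair σ (finSum N₁ N₂ H₁ H₂) HW (blockDiagFin σ H₁ H₂ g, u))) :
        symplecticGroup (polar (Matrix.toLinearMap₂' R
          (Matrix.reindex
            ((finSumFinEquiv.prodCongr (Equiv.refl (Fin M))).symm.trans (Equiv.sumProdDistrib (Fin N₁) (Fin N₂) (Fin M)))
            ((finSumFinEquiv.prodCongr (Equiv.refl (Fin M))).symm.trans (Equiv.sumProdDistrib (Fin N₁) (Fin N₂) (Fin M)))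
            (finSum N₁ N₂ T₁ T₂ ⊗ₖ TW))))) :
        (((Fin N₁ × Fin M) ⊕ (Fin N₂ × Fin M) → R) × ((Fin N₁ × Fin M) ⊕ (Fin N₂ × Fin M) → R)) ≃ₗ[R]
          (((Fin N₁ × Fin M) ⊕ (Fin N₂ × Fin M) → R) × ((Fin N₁ × Fin M) ⊕ (Fin N₂ × Fin M) → R))) =
      ((spSum (T₁ ⊗ₖ TW) (T₂ ⊗ₖ TW)
          (h.pairToSymplectic h₁ hW hσφ hσδ hH₁ hHW (dualPair σ H₁ HW (g.1, u)),
            h.pairToSymplectic h₂ hW hσφ hσδ hH₂ hHW (dualPair σ H₂ HW (g.2, u))) :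
        symplecticGroup (polar (Matrix.toLinearMap₂' R (Matrix.fromBlocks (T₁ ⊗ₖ TW) 0 0 (T₂ ⊗ₖ TW))))) :
        (((Fin N₁ × Fin M) ⊕ (Fin N₂ × Fin M) → R) × ((Fin N₁ × Fin M) ⊕ (Fin N₂ × Fin M) → R)) ≃ₗ[R]
          (((Fin N₁ × Fin M) ⊕ (Fin N₂ × Fin M) → R) × ((Fin N₁ × Fin M) ⊕ (Fin N₂ × Fin M) → R))) := by
  rw [coe_spReindex, coe_spSum]
  exact h.resAut_blockDiagFin_kroneckerGL ((g.1 : GL (Fin N₁) S), (g.2 : GL (Fin N₂) S)) (u : GL (Fin M) S)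

end GenericFin

/-! ## 1. The see-saw squares on adelic points, first member split -/

section Adelic

variable (F E : Type) [Field F] [NumberField F] [Field E] [NumberField E] [Algebra F E]
variable (c : E ≃ₐ[F] E) (N₁ N₂ M : ℕ) {J₁ : Matrix (Fin N₁) (Fin N₁) E} {J₂ : Matrix (Fin N₂) (Fin N₂) E}
  {JW : Matrix (Fin M) (Fin M) E}

/-- **The see-saw squares on adelic points, first member split** (`J_j = T_j ⊗ 1` the Gram matrices of the two
summands of `V = V₁ ⊕ V₂`, `J_W = T_W ⊗ 1`, `T`'s symmetric over `F`): for `g_j ∈ U(J_j)(𝔸_F)`, `u ∈ U(J_W)(𝔸_F)`,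
`spReindex e (toSp[V₁ ⊕ V₂, W] ((g₁ ⊕ᶠ g₂) ⊗ u)) = spSum (toSp[V₁, W] (g₁ ⊗ u), toSp[V₂, W] (g₂ ⊗ u))`
as automorphisms of `𝔸_F^{(N₁ × M) ⊕ (N₂ × M)} × 𝔸_F^{(N₁ × M) ⊕ (N₂ × M)}`
(`e = (finSumFinEquiv × 1)⁻¹ ≫ Equiv.sumProdDistrib`; the two symplectic groups have Gram matrices
`reindex e e ((T₁ ⊕ᶠ T₂) ⊗ T_W)` and `(T₁ ⊗ T_W) ⊕ (T₂ ⊗ T_W)` over `𝔸_F`, equal by `reindex_finSum_kronecker`).  This is the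
restriction of [Liu2021]'s `U(V⋆) × U(V⋆^⊥) ↪ U(V)` to the symplectic group of `Res(V ⊗ W_e)`.
[cite: Kudla1984, §1] [cite: Liu2021, proof of Thm. 4.15 (FJcycle.tex l. 2193–2210)] -/
theorem adelicPairToSymplectic_adelicBlockDiag_dualPair [Algebra.IsQuadraticExtension F E] {δ : E}
    (hcδ : c δ = -δ) (hδ : δ ≠ 0) {d : F} (hd : δ * δ = algebraMap F E d) {T₁ : Matrix (Fin N₁) (Fin N₁) F}
    {T₂ : Matrix (Fin N₂) (Fin N₂) F} {TW : Matrix (Fin M) (Fin M) F} (h₁ : T₁.IsSymm) (h₂ : T₂.IsSymm)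
    (hW : TW.IsSymm) (hJ₁ : J₁ = T₁.map (algebraMap F E)) (hJ₂ : J₂ = T₂.map (algebraMap F E))
    (hJW : JW = TW.map (algebraMap F E)) (g : adelic F E c N₁ J₁ × adelic F E c N₂ J₂) (u : adelic F E c M JW) :
    ((spReindex ((finSumFinEquiv.prodCongr (Equiv.refl (Fin M))).symm.trans
            (Equiv.sumProdDistrib (Fin N₁) (Fin N₂) (Fin M)))
          ((finSum N₁ N₂ T₁ T₂).map (algebraMap F (AdeleRing (𝓞 F) F)) ⊗ₖ TW.map (algebraMap F (AdeleRing (𝓞 F) F)))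
          (adelicPairToSymplectic F E c (N₁ + N₂) M hcδ hδ hd (isSymm_finSum h₁ h₂) hW
            (show finSum N₁ N₂ J₁ J₂ = (finSum N₁ N₂ T₁ T₂).map (algebraMap F E) by rw [hJ₁, hJ₂, finSum_map]) hJW
            (dualPair (conjAdele F E c) (adelicForm E (N₁ + N₂) (finSum N₁ N₂ J₁ J₂)) (adelicForm E M JW)
              (adelicBlockDiag F E c N₁ N₂ J₁ J₂ g, u))) :
        symplecticGroup (polar (Matrix.toLinearMap₂' (AdeleRing (𝓞 F) F)
          (Matrix.reindex
            ((finSumFinEquiv.prodCongr (Equiv.refl (Fin M))).symm.trans (Equiv.sumProdDistrib (Fin N₁) (Fin N₂) (Fin M)))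
            ((finSumFinEquiv.prodCongr (Equiv.refl (Fin M))).symm.trans (Equiv.sumProdDistrib (Fin N₁) (Fin N₂) (Fin M)))
            ((finSum N₁ N₂ T₁ T₂).map (algebraMap F (AdeleRing (𝓞 F) F)) ⊗ₖ
              TW.map (algebraMap F (AdeleRing (𝓞 F) F))))))) :
        (((Fin N₁ × Fin M) ⊕ (Fin N₂ × Fin M) → AdeleRing (𝓞 F) F) ×
            ((Fin N₁ × Fin M) ⊕ (Fin N₂ × Fin M) → AdeleRing (𝓞 F) F)) ≃ₗ[AdeleRing (𝓞 F) F]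
          (((Fin N₁ × Fin M) ⊕ (Fin N₂ × Fin M) → AdeleRing (𝓞 F) F) ×
            ((Fin N₁ × Fin M) ⊕ (Fin N₂ × Fin M) → AdeleRing (𝓞 F) F))) =
      ((spSum (T₁.map (algebraMap F (AdeleRing (𝓞 F) F)) ⊗ₖ TW.map (algebraMap F (AdeleRing (𝓞 F) F)))
          (T₂.map (algebraMap F (AdeleRing (𝓞 F) F)) ⊗ₖ TW.map (algebraMap F (AdeleRing (𝓞 F) F)))
          (adelicPairToSymplectic F E c N₁ M hcδ hδ hd h₁ hW hJ₁ hJW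
              (dualPair (conjAdele F E c) (adelicForm E N₁ J₁) (adelicForm E M JW) (g.1, u)),
            adelicPairToSymplectic F E c N₂ M hcδ hδ hd h₂ hW hJ₂ hJW
              (dualPair (conjAdele F E c) (adelicForm E N₂ J₂) (adelicForm E M JW) (g.2, u))) :
        symplecticGroup (polar (Matrix.toLinearMap₂' (AdeleRing (𝓞 F) F)
          (Matrix.fromBlocks
            (T₁.map (algebraMap F (AdeleRing (𝓞 F) F)) ⊗ₖ TW.map (algebraMap F (AdeleRing (𝓞 F) F))) 0 0
            (T₂.map (algebraMap F (AdeleRing (𝓞 F) F)) ⊗ₖ TW.map (algebraMap F (AdeleRing (𝓞 F) F))))))) :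
        (((Fin N₁ × Fin M) ⊕ (Fin N₂ × Fin M) → AdeleRing (𝓞 F) F) ×
            ((Fin N₁ × Fin M) ⊕ (Fin N₂ × Fin M) → AdeleRing (𝓞 F) F)) ≃ₗ[AdeleRing (𝓞 F) F]
          (((Fin N₁ × Fin M) ⊕ (Fin N₂ × Fin M) → AdeleRing (𝓞 F) F) ×
            ((Fin N₁ × Fin M) ⊕ (Fin N₂ × Fin M) → AdeleRing (𝓞 F) F))) := by
  rw [coe_spReindex, coe_spSum]
  exact (isQuadraticCoordinates_adele E c hcδ hδ hd).resAut_blockDiagFin_kroneckerGL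
    ((g.1 : GL (Fin N₁) (AdeleRing (𝓞 E) E)), (g.2 : GL (Fin N₂) (AdeleRing (𝓞 E) E)))
    (u : GL (Fin M) (AdeleRing (𝓞 E) E))

end Adelic

end UnitaryGroup

end Literature.NumberTheory.Automorphic

end
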